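import Literature.Analysis.FunctionSpaces.BesovDifference
import Literature.Analysis.FunctionSpaces.TorusFluidGlue
import Literature.Analysis.FunctionSpaces.TorusTestFunction
import Literature.Analysis.FluidPDE.LerayHopf
import Mathlib.Analysis.SpecialFunctions.Pow.Continuity
import HarnessLib

/-!
# Barrier (AnomalousDissipation): the Onsager singularity theorem for Leray solutions
(D-0021 barrier catalogue for `Summits/AnomalousDissipation`; summit statement
`AnomalousDissipation := Literature.Turb.ZerothLaw`)

Drivas–Eyink, *An Onsager singularity theorem for Leray solutions of incompressible
Navier–Stokes*, Nonlinearity 32 (2019) 4465–4482 (= arXiv:1710.05205), Lemma 1 (with Theorem 1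
as its corollary): Leray solutions of the forced Navier–Stokes equations on `T^d × [0,T]` whose
norms in `L³(0,T; B^σ_{3,∞}(T^d))` are bounded uniformly in the viscosity (data uniformly in
`B^σ_{2,∞}`, forces uniformly in `L²(0,T; B^σ_{2,∞})`) dissipate at most
`C ν^{(3σ-1)/(σ+1)}` of energy on `[0,T]`; for `σ > 1/3` this vanishes as `ν → 0`, so a
vanishing-viscosity family exhibiting anomalous dissipation cannot be bounded in any such class
with `σ > 1/3` ("quasi-singularities are required in the Leray solutions").

## What is vendored

* `DrivasEyink2019_lemma1_measurable` — **the barrier** (Lemma 1 as printed), rendered on the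
  flat unit torus with the accepted notions: Leray solutions `Torus.IsLerayHopfOn T ν f u₀ u`
  (`Literature.Analysis.FluidPDE.LerayHopf`) with solenoidal forces that are jointly measurable
  on `(0,T) × T^d` (`AEStronglyMeasurable (stLift (f j)) (volume.restrict (Ioo 0 T ×ˢ univ))`,
  the measurability half of the printed "`f^ν ∈ L²([0,T]; B^{σ,∞}_2(T^d))`", recorded exactly as
  the velocity's measurability is recorded in `Torus.IsWeakNSSolutionForcedOn`), Nikol'skii–Besov
  norms `eBesovSupNorm` / `eLpBesovSupNorm` with the guarded classes `MemBesovSup σ 2 · volume`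
  (data, printed "`u₀^ν ∈ B^{σ,∞}_2(T^d)`") and `MemLpBesovSup q σ p · volume (Ioo 0 T)` (forces,
  solutions) of `Literature.Analysis.FunctionSpaces.BesovDifference` — membership and uniform
  bound are both stated, as in `Literature.Analysis.FluidPDE.duchon_robert_defect_zero_of_besov` —
  and the viscous dissipation `ν ∫₀ᵀ ‖∇u‖₂²` through the spectral `Torus.eGradNormSq` (the
  quantity entering the Leray–Hopf energy inequality). Two reductions relative to print: the
  printed left-hand side is the *total* dissipation `∫₀ᵀ∫ ε[u^ν]`,
  `ε[u^ν] = ν|∇u^ν|² + D[u^ν]` with `D[u^ν] ≥ 0` the defect measure of possible Leray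
  singularities (op. cit. §1, definition of `ε[u^ν]`); the inequality is recorded here for its
  viscous part `ν|∇u^ν|²` only, which the printed one implies. The printed bound is
  *asymptotic* — "`= O(ν^{(3σ-1)/(σ+1)})`", obtained from `O(ℓ^{3σ-1}) + O(νℓ^{2(σ-1)})` with
  `ℓ ∼ ν^{1/(σ+1)} → 0` (op. cit. §2, proof of Lemma 1; abstract: "an upper bound … of the form
  `O(ν^{(3σ-1)/(σ+1)})`") — so it is rendered in `O`-form: there are `ν₀ > 0` and `C` such that
  the bound holds for every member of the family with `ν_j ≤ ν₀` (for `σ < 1/3` the exponent is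
  negative and no bound uniform over *large* `ν` is printed or true). The printed conclusion holds
  "for a.e. `T ≥ 0`" (through the a.e.-`T` energy balance); for the viscous part recorded here
  the bound at a.e. `T' ≤ T` gives it at every `T' ≤ T`, since `ν∫₀^{T'}‖∇u‖²` is monotone in
  `T'` and the norms over `[0,T']` are dominated by those over `[0,T]`. The family is indexed by
  `j : ℕ` (any countable family `ν_j > 0`). The barrier docstring block (technique class /
  blocks / because / evasions / scope / status) sits on this declaration. It is **discharged** in
  the sibling `OnsagerSingularityLerayProofs` (`DrivasEyink2019_lemma1_measurable_holds`, with
  the unconditional `ε`-form `DrivasEyink2019_noAnomalousDissipation`): the printed proof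
  reduces it to the global balance of resolved energy of Leray solutions (op. cit. Lemma 2; named
  fact `Literature.Analysis.FluidPDE.Torus.IsLerayHopfOn.resolvedEnergyBalance` of
  `Literature/Analysis/FluidPDE/LerayResolvedEnergy`, discharged as
  `Torus.IsLerayHopfOn.resolvedEnergyBalance_holds` in
  `Literature/Analysis/FluidPDE/LerayResolvedEnergyProofs`) plus the coarse-graining estimates
  proved in `Literature/Analysis/FluidPDE/CoarseGrainingEstimates`.
* `DrivasEyink2019_lemma1_measurable.noAnomalousDissipation` — the `ε`-form corollary (Thm. 1
  with `α = 0`): under the same hypotheses with `σ > 1/3` and `ν_j → 0` the dissipation on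
  `[0,T]` tends to `0`; proved from the named fact.

## Deprecated (2026-08-15): the mis-stated first rendering `DrivasEyink2019_lemma1`

The first rendering `DrivasEyink2019_lemma1` of Lemma 1 (landed before the corrected statement)
is **mis-stated — its Lean text is stronger than the source** — and is kept verbatim, statement
unchanged, under `@[deprecated DrivasEyink2019_lemma1_measurable]` at the end of this file
(human ruling of 2026-08-15 on mis-stated facts: restate, do not delete; the name is cited by
the barrier sections of several `Summits/AnomalousDissipation` theses). *What is wrong:* it
quantifies over forces `f j` with no joint measurability on `(0,T) × T^d` (only the class
`MemLpBesovSup`, which records a.e.-in-time spatial membership and a bound on a lower Lebesgue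
integral in time, `BesovDifference`) and over data `u₀ j` subject only to a bound on the total
functional `eBesovSupNorm` (an `eLpNorm` plus a seminorm — no membership `MemBesovSup`, hence no
measurability). The source assumes `f^ν ∈ L²([0,T]; B^{σ,∞}_2(T^d))` and
`u₀^ν ∈ B^{σ,∞}_2(T^d)` (op. cit. Thm. 1, and Lemma 1: "with `σ`, `u₀^ν`, and `f^ν` as in
Theorem 1", arXiv p. 3), i.e. genuine Bochner-measurable elements of these spaces, and its proof
uses this: the mollified velocity is tested against the force (`∫₀ᵀ∫ τ_ℓ(u; f)`, proof of
Lemma 2 and (Otherest2)), and the data cumulant `½∫τ_ℓ(u₀; u₀)` is computed by Fubini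
(Otherest1). In the tree's weak formulation (`Torus.IsWeakNSSolutionForcedOn`, which records the
joint measurability of the *velocity* only) and energy inequality
(`Torus.IsLerayHopfOn.energy_ineq_zero`) the force enters only through Bochner integrals
`∫∫⟪f, ψ⟫`, `∫₀ᵗ∫⟪f, u⟫`, which take the junk value `0` on non-integrable (e.g. non-measurable)
integrands, and the datum only through `Torus.kineticEnergy u₀`, the pairings `∫⟪u₀, w⟫`,
`∫⟪u₀, ψ 0⟫` and the lower integral `eLpNorm (u t - u₀) 2 volume` (`strong_initial`); for
non-measurable `f`, `u₀` these carry no usable information, so the printed argument does not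
establish the Lean statement as written and no `DrivasEyink2019_lemma1_holds` is to be expected.
`DrivasEyink2019_lemma1_measurable` restores the two printed hypotheses and is otherwise
verbatim. The two dependents of the deprecated statement are deprecated with it and kept as
machine-checked records: `DrivasEyink2019_lemma1.measurable` (the original implies the corrected
statement — the correction only *adds* hypotheses) and `DrivasEyink2019_lemma1.noAnomalousDissipation`
(its `ε`-form corollary; use `DrivasEyink2019_lemma1_measurable.noAnomalousDissipation` or the
unconditional `DrivasEyink2019_noAnomalousDissipation` of the proofs file). The deprecated
declaration carries no barrier block: the catalogue entry is `DrivasEyink2019_lemma1_measurable`.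

## References

* T. D. Drivas, G. L. Eyink, Nonlinearity 32 (2019) = arXiv:1710.05205, Thm. 1, Lemma 1 (p. 3),
  Lemma 2, Remarks 1–2, 4.
* P. Constantin, W. E, E. S. Titi, Comm. Math. Phys. 165 (1994) (commutator estimate used in
  the proof of Lemma 1).
-/

open MeasureTheory Set Filter Topology
open scoped ENNReal NNReal

noncomputable section

namespace Literature.Barriers.AnomalousDissipation

/-- **Drivas–Eyink Onsager singularity theorem, quantitative form** (Drivas–Eyink,
Nonlinearity 32 (2019), Lemma 1; Theorem 1 is its corollary) — the barrier of this file
(measurable-data statement; it supersedes the deprecated, mis-stated first rendering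
`DrivasEyink2019_lemma1` at the end of the file, from which it differs exactly by the two
hypotheses of the source that the latter dropped — see the module docstring, §Deprecated: the
forces are jointly measurable on `(0,T) × T^d`,
`AEStronglyMeasurable (stLift (f j)) (volume.restrict (Ioo 0 T ×ˢ univ))`, the measurability
half of the printed "`f^ν ∈ L²([0,T]; B^{σ,∞}_2(T^d))`", recorded exactly as for the velocity in
`Torus.IsWeakNSSolutionForcedOn`, and the data lie in the Besov space,
`MemBesovSup σ 2 (u₀ j) volume`, printed "`u₀^ν ∈ B^{σ,∞}_2(T^d)`"; membership and uniform
bound are both stated, as for `f j` and `u j`). Statement: let `σ ∈ (0,1]`, `T > 0`, and let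
`(u_j)` be Leray solutions of the incompressible Navier–Stokes equations on `T^d × [0,T]` with
viscosities `ν_j > 0`, solenoidal measurable body forces `f_j ∈ L²(0,T; B^σ_{2,∞})` and data
`u₀,ⱼ ∈ B^σ_{2,∞}`, such that `sup_j ‖u₀,ⱼ‖_{B^σ_{2,∞}} < ∞`, `sup_j ‖f_j‖_{L²(0,T;B^σ_{2,∞})} < ∞`
and "`u^ν ∈ L³(0,T; B^σ_{3,∞}(T^d))` with all the above Besov norms bounded, uniformly in
viscosity": `sup_j ‖u_j‖_{L³(0,T;B^σ_{3,∞})} < ∞` (membership is the guarded `MemLpBesovSup` —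
`u_j(t) ∈ B^σ_{3,∞}` for a.e. `t ∈ (0,T)` and finite `L^q_t`-norm — stated *together with* the
uniform bound on `eLpBesovSupNorm`, whose integrand is the junk value `0` at times where the
slice is not in the Besov space). Then the energy dissipation is `O(ν^{(3σ-1)/(σ+1)})`: there
are `ν₀ > 0` and a constant `C`, independent of `j`, with
`ν_j ∫₀ᵀ ‖∇u_j(t)‖₂² dt ≤ C ν_j^{(3σ-1)/(σ+1)}` for all `j` with `ν_j ≤ ν₀` (printed as
`∫₀ᵀ∫ ε[u^ν] ≤ C ν^{(3σ-1)/(σ+1)}` for a.e. `T`, for the total dissipation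
`ε = ν|∇u|² + D[u] ≥ ν|∇u|²`, `D ≥ 0`, and derived asymptotically as `ν → 0`, op. cit. §1–2;
recorded for the viscous part, in `O`-form, at the endpoint `T` — see the module docstring for
the two reductions). In particular the dissipation tends to `0` whenever `σ > 1/3` (op. cit.
Thm. 1 with `α = 0`; `DrivasEyink2019_lemma1_measurable.noAnomalousDissipation`).
**Discharged**: `DrivasEyink2019_lemma1_measurable_holds`
(`Literature/Barriers/AnomalousDissipation/OnsagerSingularityLerayProofs`).

BARRIER (D-0021):
- technique_class: uniform-regularity onsager-supercritical-bounds a-priori-besov-holder-bounds smooth-approximation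
- blocks: any witness family for `Literature.Turb.ZerothLaw` (= `AnomalousDissipation`) read on a finite window `[0,T]`, and any witness for the finite-time versions `Literature.Analysis.FluidPDE.BrueDeLellisQuestion21` / `BrueDeLellisQuestion22`, whose Leray–Hopf solutions (measurable solenoidal forces, Besov data) stay bounded in `L³(0,T; B^σ_{3,∞}(T³))` uniformly in `ν` for some `σ > 1/3` (data and forces uniformly in `B^σ_{2,∞}`, automatic for a fixed smooth steady force): their dissipation on `[0,T]` is `O(ν^{(3σ-1)/(σ+1)}) → 0` [cite: DrivasEyink2019, Lemma 1 and Thm. 1].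
- because: the global balance of resolved energy of a Leray solution (op. cit. Lemma 2) expresses the dissipation as energy flux `Π_ℓ` plus resolved dissipation plus data and force cumulants; the Constantin–E–Titi commutator estimate gives `‖Π_ℓ‖_{L¹} ≤ C ℓ^{3σ-1} ‖u‖³_{L³B^σ_{3,∞}}`, the resolved dissipation is `O(ν ℓ^{2(σ-1)})`, the cumulants are `O(ℓ^{2σ})`, and `ℓ ∼ ν^{1/(σ+1)}` yields `O(ν^{(3σ-1)/(σ+1)})` [cite: DrivasEyink2019, §2, proof of Lemma 1].
- evasions_known: witness families must develop Onsager-type quasi-singularities, i.e. lose uniform `B^σ_{3,∞}` regularity for every `σ > 1/3` [cite: DrivasEyink2019, Thm. 1, Remark 4]; realised at the critical exponent with `ν`-dependent forces [cite: BCCDS2024, Thm. 1.1] (`Literature.Analysis.FluidPDE.bccds_onsager_critical`) and with forces uniformly in `C⁰_t C^α_x`, `α < 1` [cite: BrueDeLellis2023, Thm. 1.1]; the sharpened `B^{σ}_{3,c₀}` form removes the `ε` [cite: DrivasEyink2019, Remark 2].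
- scope_caveats: finite windows `[0,T]` only — the constant depends on `T` and on the three uniform Besov bounds, so nothing is asserted about `limsup_{T→∞}` time averages unless the bounds are uniform in `T`; asymptotic in `ν` (`ν ≤ ν₀`); Leray solutions on `T^d` with measurable solenoidal `L²_t B^σ_{2,∞}` forcing and `B^σ_{2,∞}` data as printed; the printed left-hand side also contains the Leray defect `D[u^ν] ≥ 0`, dropped here [cite: DrivasEyink2019, Lemma 1 and §2].
- status: established (theorem; discharged in the tree as `DrivasEyink2019_lemma1_measurable_holds`, `OnsagerSingularityLerayProofs`) [cite: DrivasEyink2019, Lemma 1] -/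
def DrivasEyink2019_lemma1_measurable : Prop :=
  ∀ (d : Type) [Fintype d] [DecidableEq d] (T : ℝ) (_hT : 0 < T) (σ : ℝ) (_hσ : 0 < σ ∧ σ ≤ 1)
    (ν : ℕ → ℝ) (_hν : ∀ j, 0 < ν j)
    (f : ℕ → ℝ → UnitAddTorus d → EuclideanSpace ℝ d)
    (u₀ : ℕ → UnitAddTorus d → EuclideanSpace ℝ d)
    (u : ℕ → ℝ → UnitAddTorus d → EuclideanSpace ℝ d)
    (_hLeray : ∀ j, Literature.Analysis.FluidPDE.Torus.IsLerayHopfOn T (ν j) (f j) (u₀ j) (u j))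
    (_hf_div : ∀ j t, Literature.Analysis.FunctionSpaces.Torus.IsWeaklyDivFree (f j t))
    (_hf_meas : ∀ j, AEStronglyMeasurable (Literature.Analysis.FunctionSpaces.Torus.stLift (f j))
      (volume.restrict (Ioo 0 T ×ˢ univ)))
    (_hdata_mem : ∀ j, Literature.Analysis.FunctionSpaces.MemBesovSup σ 2 (u₀ j) volume)
    (_hdata : ∃ M₀ : ℝ≥0, ∀ j, Literature.Analysis.FunctionSpaces.eBesovSupNorm σ 2 (u₀ j) volume ≤ M₀)
    (_hforce_mem : ∀ j, Literature.Analysis.FunctionSpaces.MemLpBesovSup 2 σ 2 (f j) volume (Ioo 0 T))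
    (_hforce : ∃ M₁ : ℝ≥0, ∀ j, Literature.Analysis.FunctionSpaces.eLpBesovSupNorm 2 σ 2 (f j) volume (Ioo 0 T) ≤ M₁)
    (_hsol_mem : ∀ j, Literature.Analysis.FunctionSpaces.MemLpBesovSup 3 σ 3 (u j) volume (Ioo 0 T))
    (_hsol : ∃ M₂ : ℝ≥0, ∀ j, Literature.Analysis.FunctionSpaces.eLpBesovSupNorm 3 σ 3 (u j) volume (Ioo 0 T) ≤ M₂),
    ∃ ν₀ : ℝ, 0 < ν₀ ∧ ∃ C : ℝ, ∀ j, ν j ≤ ν₀ →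
      ν j * (∫⁻ τ in Ioo 0 T, Literature.Analysis.FunctionSpaces.Torus.eGradNormSq (u j τ)).toReal ≤
        C * ν j ^ ((3 * σ - 1) / (σ + 1))

/-- **Corollary (the barrier in `ε`-form).** Under the hypotheses of
`DrivasEyink2019_lemma1_measurable` with `σ > 1/3`, if moreover `ν_j → 0` (so that `ν_j ≤ ν₀`
eventually) then the dissipation on `[0,T]` tends to `0`: no anomalous dissipation for families
of Leray solutions with measurable forces and Besov data that are uniformly bounded in
`L³(0,T; B^σ_{3,∞})`, `σ > 1/3` (Drivas–Eyink 2019, Thm. 1 with `α = 0` / abstract). Proved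
here from the named fact; unconditional form `DrivasEyink2019_noAnomalousDissipation` in the
proofs file. [cite: DrivasEyink2019, Thm. 1] -/
theorem DrivasEyink2019_lemma1_measurable.noAnomalousDissipation
    (h : DrivasEyink2019_lemma1_measurable)
    (d : Type) [Fintype d] [DecidableEq d] (T : ℝ) (hT : 0 < T) (σ : ℝ) (hσ : 1 / 3 < σ ∧ σ ≤ 1)
    (ν : ℕ → ℝ) (hν : ∀ j, 0 < ν j) (hν₀ : Tendsto ν atTop (𝓝 0))
    (f : ℕ → ℝ → UnitAddTorus d → EuclideanSpace ℝ d)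
    (u₀ : ℕ → UnitAddTorus d → EuclideanSpace ℝ d)
    (u : ℕ → ℝ → UnitAddTorus d → EuclideanSpace ℝ d)
    (hLeray : ∀ j, Literature.Analysis.FluidPDE.Torus.IsLerayHopfOn T (ν j) (f j) (u₀ j) (u j))
    (hf_div : ∀ j t, Literature.Analysis.FunctionSpaces.Torus.IsWeaklyDivFree (f j t))
    (hf_meas : ∀ j, AEStronglyMeasurable (Literature.Analysis.FunctionSpaces.Torus.stLift (f j))
      (volume.restrict (Ioo 0 T ×ˢ univ)))
    (hdata_mem : ∀ j, Literature.Analysis.FunctionSpaces.MemBesovSup σ 2 (u₀ j) volume)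
    (hdata : ∃ M₀ : ℝ≥0, ∀ j, Literature.Analysis.FunctionSpaces.eBesovSupNorm σ 2 (u₀ j) volume ≤ M₀)
    (hforce_mem : ∀ j, Literature.Analysis.FunctionSpaces.MemLpBesovSup 2 σ 2 (f j) volume (Ioo 0 T))
    (hforce : ∃ M₁ : ℝ≥0, ∀ j, Literature.Analysis.FunctionSpaces.eLpBesovSupNorm 2 σ 2 (f j) volume (Ioo 0 T) ≤ M₁)
    (hsol_mem : ∀ j, Literature.Analysis.FunctionSpaces.MemLpBesovSup 3 σ 3 (u j) volume (Ioo 0 T))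
    (hsol : ∃ M₂ : ℝ≥0, ∀ j, Literature.Analysis.FunctionSpaces.eLpBesovSupNorm 3 σ 3 (u j) volume (Ioo 0 T) ≤ M₂) :
    Tendsto (fun j => ν j * (∫⁻ τ in Ioo 0 T, Literature.Analysis.FunctionSpaces.Torus.eGradNormSq (u j τ)).toReal)
      atTop (𝓝 0) := by
  obtain ⟨ν₀, hν₀pos, C, hC⟩ := h d T hT σ ⟨by linarith [hσ.1], hσ.2⟩ ν hν f u₀ u hLeray hf_div
    hf_meas hdata_mem hdata hforce_mem hforce hsol_mem hsol
  have hexp : 0 < (3 * σ - 1) / (σ + 1) := div_pos (by linarith [hσ.1]) (by linarith [hσ.1])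
  -- the upper bound `C ν_j^p → 0`
  have hpow : Tendsto (fun j => ν j ^ ((3 * σ - 1) / (σ + 1))) atTop (𝓝 0) :=
    hν₀.rpow_const_nhds_zero hexp
  have hup : Tendsto (fun j => C * ν j ^ ((3 * σ - 1) / (σ + 1))) atTop (𝓝 0) := by
    simpa using hpow.const_mul C
  -- eventually `ν_j ≤ ν₀`, where the bound applies
  have hev : ∀ᶠ j in atTop, ν j ≤ ν₀ := (hν₀.eventually (Iic_mem_nhds hν₀pos)).mono fun j hj => hj
  refine squeeze_zero' (Eventually.of_forall fun j => ?_) (hev.mono fun j hj => hC j hj) hup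
  exact mul_nonneg (hν j).le ENNReal.toReal_nonneg

/-! ## Deprecated (2026-08-15): the mis-stated first rendering and its two dependents

See the module docstring, §Deprecated. The three declarations below are kept verbatim
(statements and proofs unchanged) under `@[deprecated]`; nothing new should use them. -/

/-- **Deprecated** (2026-08-15) — **mis-stated: the Lean text is stronger than the source**;
superseded by `DrivasEyink2019_lemma1_measurable` (above; discharged as
`DrivasEyink2019_lemma1_measurable_holds` in `OnsagerSingularityLerayProofs`), which adds the two
hypotheses of the source that this rendering dropped — joint measurability of the forces `f j`
on `(0,T) × T^d` and Besov membership `MemBesovSup σ 2 (u₀ j) volume` of the data — and keeps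
every other hypothesis and the conclusion verbatim (`DrivasEyink2019_lemma1.measurable` records
that this statement implies the corrected one). *What is wrong:* the source (Drivas–Eyink,
Nonlinearity 32 (2019), Lemma 1 with Thm. 1, arXiv:1710.05205 p. 3) assumes
`f^ν ∈ L²([0,T]; B^{σ,∞}_2(T^d))` and `u₀^ν ∈ B^{σ,∞}_2(T^d)`, Bochner-measurable elements, and
its proof tests the mollified velocity against the force and computes the data cumulant by
Fubini; the hypotheses below give the forces only the class `MemLpBesovSup` (a.e.-in-time slice
membership, no joint measurability) and the data only a bound on the functional `eBesovSupNorm`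
(no membership, no measurability), while in `Torus.IsLerayHopfOn` the force and the datum enter
only through Bochner integrals and pairings that are junk (`0`) on non-measurable integrands — so
the statement quantifies over families the printed argument says nothing about, is not implied
by its source, and no `_holds` theorem is to be expected (module docstring, §Deprecated). Kept
verbatim (statement unchanged) under its theses-cited name by the human ruling of 2026-08-15 on
mis-stated facts; it carries no barrier block (the catalogue entry is
`DrivasEyink2019_lemma1_measurable`). Do not take `(h : DrivasEyink2019_lemma1)` as a hypothesis.
*Original content* — Drivas–Eyink Onsager singularity theorem, quantitative form (Lemma 1): for
`σ ∈ (0,1]`, `T > 0`, Leray solutions `u_j` on `T^d × [0,T]` with viscosities `ν_j > 0`,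
solenoidal forces `f_j` and data `u₀,ⱼ` with `sup_j ‖u₀,ⱼ‖_{B^σ_{2,∞}}`,
`sup_j ‖f_j‖_{L²(0,T;B^σ_{2,∞})}`, `sup_j ‖u_j‖_{L³(0,T;B^σ_{3,∞})}` finite (memberships
`MemLpBesovSup` for `f_j`, `u_j`), there are `ν₀ > 0` and `C` with
`ν_j ∫₀ᵀ ‖∇u_j‖₂² ≤ C ν_j^{(3σ-1)/(σ+1)}` whenever `ν_j ≤ ν₀`.
[cite: DrivasEyink2019, Lemma 1 — mis-rendered hypotheses, see the deprecation note; corrected as DrivasEyink2019_lemma1_measurable] -/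
@[deprecated DrivasEyink2019_lemma1_measurable (since := "2026-08-15")]
def DrivasEyink2019_lemma1 : Prop :=
  ∀ (d : Type) [Fintype d] [DecidableEq d] (T : ℝ) (_hT : 0 < T) (σ : ℝ) (_hσ : 0 < σ ∧ σ ≤ 1)
    (ν : ℕ → ℝ) (_hν : ∀ j, 0 < ν j)
    (f : ℕ → ℝ → UnitAddTorus d → EuclideanSpace ℝ d)
    (u₀ : ℕ → UnitAddTorus d → EuclideanSpace ℝ d)
    (u : ℕ → ℝ → UnitAddTorus d → EuclideanSpace ℝ d)
    (_hLeray : ∀ j, Literature.Analysis.FluidPDE.Torus.IsLerayHopfOn T (ν j) (f j) (u₀ j) (u j))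
    (_hf_div : ∀ j t, Literature.Analysis.FunctionSpaces.Torus.IsWeaklyDivFree (f j t))
    (_hdata : ∃ M₀ : ℝ≥0, ∀ j, Literature.Analysis.FunctionSpaces.eBesovSupNorm σ 2 (u₀ j) volume ≤ M₀)
    (_hforce_mem : ∀ j, Literature.Analysis.FunctionSpaces.MemLpBesovSup 2 σ 2 (f j) volume (Ioo 0 T))
    (_hforce : ∃ M₁ : ℝ≥0, ∀ j, Literature.Analysis.FunctionSpaces.eLpBesovSupNorm 2 σ 2 (f j) volume (Ioo 0 T) ≤ M₁)
    (_hsol_mem : ∀ j, Literature.Analysis.FunctionSpaces.MemLpBesovSup 3 σ 3 (u j) volume (Ioo 0 T))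
    (_hsol : ∃ M₂ : ℝ≥0, ∀ j, Literature.Analysis.FunctionSpaces.eLpBesovSupNorm 3 σ 3 (u j) volume (Ioo 0 T) ≤ M₂),
    ∃ ν₀ : ℝ, 0 < ν₀ ∧ ∃ C : ℝ, ∀ j, ν j ≤ ν₀ →
      ν j * (∫⁻ τ in Ioo 0 T, Literature.Analysis.FunctionSpaces.Torus.eGradNormSq (u j τ)).toReal ≤
        C * ν j ^ ((3 * σ - 1) / (σ + 1))

/-- **Deprecated** (2026-08-15) together with its hypothesis, the mis-stated
`DrivasEyink2019_lemma1`: use `DrivasEyink2019_lemma1_measurable_holds`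
(`OnsagerSingularityLerayProofs`) directly. *Content (unchanged):* the original (unguarded)
statement implies the corrected one — the latter only adds hypotheses — recorded as the check
that the corrected statement is not stronger than the original. [folklore] -/
@[deprecated "the hypothesis `DrivasEyink2019_lemma1` is mis-stated; the conclusion is proved outright: use Literature.Barriers.AnomalousDissipation.DrivasEyink2019_lemma1_measurable_holds (OnsagerSingularityLerayProofs.lean)" (since := "2026-08-15")]
theorem DrivasEyink2019_lemma1.measurable (h : DrivasEyink2019_lemma1) :
    DrivasEyink2019_lemma1_measurable :=
  fun d _ _ T hT σ hσ ν hν f u₀ u hLeray hf_div _ _ hdata hforce_mem hforce hsol_mem hsol =>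
    h d T hT σ hσ ν hν f u₀ u hLeray hf_div hdata hforce_mem hforce hsol_mem hsol

/-- **Deprecated** (2026-08-15) together with its hypothesis, the mis-stated
`DrivasEyink2019_lemma1`: use `DrivasEyink2019_lemma1_measurable.noAnomalousDissipation` (above)
or the unconditional `DrivasEyink2019_noAnomalousDissipation` (`OnsagerSingularityLerayProofs`).
*Content (unchanged):* the barrier in `ε`-form from the mis-stated rendering — under the
hypotheses of `DrivasEyink2019_lemma1` with `σ > 1/3`, if moreover `ν_j → 0` (so that
`ν_j ≤ ν₀` eventually) then the dissipation on `[0,T]` tends to `0` (Drivas–Eyink 2019, Thm. 1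
with `α = 0` / abstract), proved from that named fact. [cite: DrivasEyink2019, Thm. 1] -/
@[deprecated DrivasEyink2019_lemma1_measurable.noAnomalousDissipation (since := "2026-08-15")]
theorem DrivasEyink2019_lemma1.noAnomalousDissipation (h : DrivasEyink2019_lemma1)
    (d : Type) [Fintype d] [DecidableEq d] (T : ℝ) (hT : 0 < T) (σ : ℝ) (hσ : 1 / 3 < σ ∧ σ ≤ 1)
    (ν : ℕ → ℝ) (hν : ∀ j, 0 < ν j) (hν₀ : Tendsto ν atTop (𝓝 0))
    (f : ℕ → ℝ → UnitAddTorus d → EuclideanSpace ℝ d)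
    (u₀ : ℕ → UnitAddTorus d → EuclideanSpace ℝ d)
    (u : ℕ → ℝ → UnitAddTorus d → EuclideanSpace ℝ d)
    (hLeray : ∀ j, Literature.Analysis.FluidPDE.Torus.IsLerayHopfOn T (ν j) (f j) (u₀ j) (u j))
    (hf_div : ∀ j t, Literature.Analysis.FunctionSpaces.Torus.IsWeaklyDivFree (f j t))
    (hdata : ∃ M₀ : ℝ≥0, ∀ j, Literature.Analysis.FunctionSpaces.eBesovSupNorm σ 2 (u₀ j) volume ≤ M₀)
    (hforce_mem : ∀ j, Literature.Analysis.FunctionSpaces.MemLpBesovSup 2 σ 2 (f j) volume (Ioo 0 T))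
    (hforce : ∃ M₁ : ℝ≥0, ∀ j, Literature.Analysis.FunctionSpaces.eLpBesovSupNorm 2 σ 2 (f j) volume (Ioo 0 T) ≤ M₁)
    (hsol_mem : ∀ j, Literature.Analysis.FunctionSpaces.MemLpBesovSup 3 σ 3 (u j) volume (Ioo 0 T))
    (hsol : ∃ M₂ : ℝ≥0, ∀ j, Literature.Analysis.FunctionSpaces.eLpBesovSupNorm 3 σ 3 (u j) volume (Ioo 0 T) ≤ M₂) :
    Tendsto (fun j => ν j * (∫⁻ τ in Ioo 0 T, Literature.Analysis.FunctionSpaces.Torus.eGradNormSq (u j τ)).toReal)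
      atTop (𝓝 0) := by
  obtain ⟨ν₀, hν₀pos, C, hC⟩ := h d T hT σ ⟨by linarith [hσ.1], hσ.2⟩ ν hν f u₀ u hLeray hf_div
    hdata hforce_mem hforce hsol_mem hsol
  have hexp : 0 < (3 * σ - 1) / (σ + 1) := div_pos (by linarith [hσ.1]) (by linarith [hσ.1])
  -- the upper bound `C ν_j^p → 0`
  have hpow : Tendsto (fun j => ν j ^ ((3 * σ - 1) / (σ + 1))) atTop (𝓝 0) :=
    hν₀.rpow_const_nhds_zero hexp
  have hup : Tendsto (fun j => C * ν j ^ ((3 * σ - 1) / (σ + 1))) atTop (𝓝 0) := by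
    simpa using hpow.const_mul C
  -- eventually `ν_j ≤ ν₀`, where the bound applies
  have hev : ∀ᶠ j in atTop, ν j ≤ ν₀ := (hν₀.eventually (Iic_mem_nhds hν₀pos)).mono fun j hj => hj
  refine squeeze_zero' (Eventually.of_forall fun j => ?_) (hev.mono fun j hj => hC j hj) hup
  exact mul_nonneg (hν j).le ENNReal.toReal_nonneg

end Literature.Barriers.AnomalousDissipation

end
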